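import Summits.PneNP.PneNP.Theorems.NegLimitedAmplifiedWindowAmpDefs
import Summits.PneNP.PneNP.Theorems.NegLimitedDoorHardCore
import Summits.PneNP.PneNP.Theorems.NegLimitedDoorThresholdCircuits
import Literature.Computability.Complexity.CircuitClassesProofs
import Mathlib
import HarnessLib

/-!
# Amplified critical window — stub A, parts A0 `BlockRestriction` and A1 `HardCoreMonotone` (circuit side)
(cell pnp-ideate, rung F-N1/p3, ROUND-12; line `amplified-window` on item stmt-PneNP-19860, stub A
`MonotoneAmplification`; typed parts of `NegLimitedAmplifiedWindowAmpDefs.lean`, blueprint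
HOME/pnp-ideate-p3/r12/BLUEPRINT-A.md §2–§3)

* `blockRestriction_holds : BlockRestriction` — fixing every block but one of a `{∧₂,∨₂,0,1}`-circuit
  costs two gates (one constant-`1`, one constant-`0`), in the straight-line algebra `CktSize`
  (`CktSize.id/pair/outMap/comp`, `Circuit.cktSize_eval`, `CktSize.toCircuit`);
* `hardCoreMonotone_holds : HardCoreMonotone` — Impagliazzo's hard-core MEASURE for the class of
  size-`s'` monotone circuits, from the landed boosting form `NegLimitedDoor.HardCore.hardCore_measure`
  (p465156): the majority vote of `t` circuits of the class is the monotone circuit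
  `Thr_{⌊t/2⌋+1}(C₁,…,C_t)` (`CktSize.pi_const` + `Threshold.cktSize_thrFn_fin`) of size
  `≤ t·s' + (⌊t/2⌋+1)(2t+1) ≤ s`, and `{Thr ≠ f} ⊆ {vote ≤ 0}` (`vote_nonpos_of_thr_ne`); ONE-SIDED signed
  advantage throughout (referee checkpoint α).

References: R. Impagliazzo, *Hard-core distributions for somewhat hard problems*, FOCS 1995 [Impagliazzo1995];
H. Vollmer, *Introduction to Circuit Complexity* (1999), §1.2 (composition of straight-line programs).

HONEST FRAMING: sub-lemmas of the OPEN stub A; nothing here bears on P vs NP.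
-/

set_option linter.dupNamespace false -- `Summit.PneNP.PneNP.…`: summit = sub-problem name (D-0017 single-conjunct layout)

namespace Summit.PneNP.PneNP.Theorems.NegLimitedAmplifiedWindow.Amp

open Finset Function
open Literature.Computability.Complexity
open Summit.PneNP.PneNP.Theorems.NegLimitedDoor (massAt agreeAt)
open Summit.PneNP.PneNP.Theorems.NegLimitedDoor.Threshold (wt thrFn cktSize_thrFn_fin)
open Summit.PneNP.PneNP.Theorems.CliqueExtLowerBound.Negative (MonoBasis MonoBasis.monotoneBasis01 cktSize_const01)

/-! ### A0: block restriction -/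

/-- **A0 `BlockRestriction`**, BY NAME. -/
theorem blockRestriction_holds : BlockRestriction := by
  intro ι _ _ d M hM w X
  classical
  -- the input map `y ↦ (q ↦ update X w y q.1 q.2)` with two constant gates
  have hin : CktSize monotoneBasis01
      (fun (y : ι → Bool) (q : (Fin d → Fin 3) × ι) => update X w y q.1 q.2) 2 := by
    have h := ((CktSize.id (ι := ι) monotoneBasis01).pair
      ((cktSize_const01 (ι := ι) MonoBasis.monotoneBasis01 true).pair
        (cktSize_const01 (ι := ι) MonoBasis.monotoneBasis01 false))).outMap
      (fun q : (Fin d → Fin 3) × ι => if q.1 = w then (Sum.inl q.2 : ι ⊕ (Unit ⊕ Unit))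
        else if X q.1 q.2 then Sum.inr (Sum.inl ()) else Sum.inr (Sum.inr ()))
    refine h.congr fun y q => ?_
    obtain ⟨u, i⟩ := q
    by_cases hu : u = w
    · subst hu; simp
    · simp only [hu, if_false, update_of_ne hu]
      cases X u i <;> simp
  obtain ⟨C, hC, hs, he⟩ := (hin.comp (M.cktSize_eval hM)).toCircuit
  exact ⟨C, hC, by omega, fun y => he y⟩

/-! ### A1: the hard-core measure for monotone circuits -/

/-- The signed vote of `t` predictors against `f` at `x` is `2·#agreements − t`. -/
theorem vote_eq {X : Type} {t : ℕ} (gs : Fin t → X → Bool) (f : X → Bool) (x : X) :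
    ∑ i, (if gs i x = f x then (1 : ℤ) else -1) =
      2 * ((univ.filter fun i => gs i x = f x).card : ℤ) - t := by
  rw [Finset.card_filter]
  push_cast
  have hpt : ∀ i : Fin t, (if gs i x = f x then (1 : ℤ) else -1) =
      2 * (if gs i x = f x then (1 : ℤ) else 0) - 1 := fun i => by split_ifs <;> norm_num
  rw [Finset.sum_congr rfl fun i _ => hpt i, Finset.sum_sub_distrib, ← Finset.mul_sum]
  simp

/-- **Key inclusion**: where the threshold-majority `Thr_{⌊t/2⌋+1}(g₁ x, …, g_t x)` errs, the signed vote
of the `gᵢ` against `f` is `≤ 0`. -/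
theorem vote_nonpos_of_thr_ne {X : Type} {t : ℕ} (gs : Fin t → X → Bool) (f : X → Bool) (x : X)
    (h : thrFn (t / 2 + 1) (fun i => gs i x) ≠ f x) :
    ∑ i, (if gs i x = f x then (1 : ℤ) else -1) ≤ 0 := by
  rw [vote_eq]
  unfold thrFn wt at h
  set k := (univ.filter fun i : Fin t => gs i x = true).card with hk
  have hagree : ((univ.filter fun i => gs i x = f x).card : ℤ) ≤ (t : ℤ) / 2 := by
    cases hf : f x
    · -- `f x = 0`: the majority errs iff `k ≥ t/2+1`; agreements = `t − k`
      rw [hf] at h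
      have hθ : t / 2 + 1 ≤ k := by
        by_contra hlt
        exact h (by simp only [decide_eq_false_iff_not]; omega)
      have hcomp : (univ.filter fun i : Fin t => gs i x = false).card = t - k := by
        have := Finset.card_filter_add_card_filter_not (s := (univ : Finset (Fin t))) (fun i => gs i x = true)
        simp only [Finset.card_univ, Fintype.card_fin, Bool.not_eq_true] at this
        omega
      rw [hcomp]
      have : ((t - k : ℕ) : ℤ) ≤ (t : ℤ) / 2 := by omega
      exact this
    · -- `f x = 1`: the majority errs iff `k < t/2+1`; agreements = `k`
      rw [hf] at h
      have hθ : k < t / 2 + 1 := by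
        by_contra hge
        exact h (by simp only [decide_eq_true_iff]; omega)
      have : (k : ℤ) ≤ (t : ℤ) / 2 := by omega
      exact this
  omega

/-- **A1 `HardCoreMonotone`**, BY NAME. -/
theorem hardCoreMonotone_holds : HardCoreMonotone := by
  intro ι _ _ D f s s' β γ hD hD1 hβ hγ hhard hbudget
  classical
  -- the class of size-`s'` monotone circuits
  set 𝒢 : Set ((ι → Bool) → Bool) :=
    {g | ∃ C : Circuit ι, C.IsOver monotoneBasis01 ∧ C.size ≤ s' ∧ C.eval = g} with h𝒢
  -- `1 ≤ s` (budget at `t = 0`) and hence `β ≤ 1` (constant circuit)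
  have hs1 : 1 ≤ s := by
    have := hbudget 0 (by push_cast; positivity)
    simpa using this
  have hβ1 : β ≤ 1 := by
    obtain ⟨C, hC, hCs, hCe⟩ := (cktSize_const01 (ι := ι) MonoBasis.monotoneBasis01 true).toCircuit
    have h := hhard C hC (hCs.trans hs1)
    have h0 : 0 ≤ agreeAt D f C.eval := Finset.sum_nonneg fun x _ => by
      split_ifs; exacts [hD x, le_rfl]
    linarith
  -- the boosting hypothesis of `hardCore_measure`
  have hW : 0 < ∑ x, D x := by rw [hD1]; exact one_pos
  suffices hboost : ∀ (t : ℕ) (gs : Fin t → ((ι → Bool) → Bool)), (t : ℝ) ≤ 4 / (γ * β) ^ 2 + 2 / (γ * β) →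
      (∀ i, gs i ∈ 𝒢) →
      β * ∑ x, D x ≤ ∑ x ∈ univ.filter (fun x => ∑ i, (if gs i x = f x then (1 : ℤ) else -1) ≤ 0), D x by
    obtain ⟨M, hM0, hM1, hMd, hMadv⟩ := NegLimitedDoor.HardCore.hardCore_measure D hD hW f 𝒢 hγ hβ hboost
    exact ⟨M, hM0, hM1, by simpa [hD1] using hMd, fun C hC hCs => hMadv C.eval ⟨C, hC, hCs, rfl⟩⟩
  intro t gs ht hgs
  -- majority vote: `β ≤ D-mass {vote ≤ 0}`
  rw [hD1, mul_one]
  rcases Nat.eq_zero_or_pos t with rfl | ht0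
  · -- no predictors: the vote is identically `0`
    have : (univ.filter fun x : ι → Bool => ∑ i : Fin 0, (if gs i x = f x then (1 : ℤ) else -1) ≤ 0) = univ := by
      ext x; simp
    rw [this, hD1]; exact hβ1
  -- the majority circuit
  choose C hC hCs hCe using fun i => (hgs i)
  set θ := t / 2 + 1 with hθ
  have hθ1 : 1 ≤ θ := by omega
  have hpi : CktSize monotoneBasis01 (fun (x : ι → Bool) (i : Fin t) => gs i x) (t * s') := by
    have h := CktSize.pi_const (κ := Fin t) (f := fun (x : ι → Bool) (i : Fin t) => gs i x) (s := s')
      fun i => by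
        have h1 := (C i).cktSize_eval (hC i)
        rw [hCe i] at h1
        exact h1.of_le (hCs i)
    simpa using h
  have hmaj := hpi.comp (cktSize_thrFn_fin (N := t) MonoBasis.monotoneBasis01 hθ1)
  obtain ⟨Maj, hMajB, hMajs, hMaje⟩ := hmaj.toCircuit
  have hMajs' : Maj.size ≤ s := by
    have hb := hbudget t ht
    have : θ + t * (θ * 2) = (t / 2 + 1) * (2 * t + 1) := by rw [hθ]; ring
    omega
  -- the majority errs on mass `≥ β`, and its errors have vote `≤ 0`
  have hagree := hhard Maj hMajB hMajs'
  have hsplit : agreeAt D f Maj.eval + ∑ x ∈ univ.filter (fun x => Maj.eval x ≠ f x), D x = 1 := by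
    rw [← hD1, agreeAt, Finset.sum_filter, ← Finset.sum_add_distrib]
    exact Finset.sum_congr rfl fun x _ => by by_cases h : Maj.eval x = f x <;> simp [h]
  have herr : β ≤ ∑ x ∈ univ.filter (fun x => Maj.eval x ≠ f x), D x := by linarith
  refine herr.trans (Finset.sum_le_sum_of_subset_of_nonneg (fun x hx => ?_) fun x _ _ => hD x)
  simp only [Finset.mem_filter, Finset.mem_univ, true_and] at hx ⊢
  rw [hMaje x] at hx
  exact vote_nonpos_of_thr_ne gs f x hx

end Summit.PneNP.PneNP.Theorems.NegLimitedAmplifiedWindow.Amp
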